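import Summits.BirchSwinnertonDyer.BirchSwinnertonDyer.Theorems.ManinLocalTwoThreePShiftTransferPair
import Summits.BirchSwinnertonDyer.BirchSwinnertonDyer.Theorems.ManinLocalTwoThreePShiftGlue
import Summits.BirchSwinnertonDyer.BirchSwinnertonDyer.Theorems.ManinLocalTwoThreeCubeStep
import HarnessLib

/-!
# The prime-generic descent engine, I: the `K_{p,p}` step `Γ₀(p·pm) → Γ₀(pm)` inside `G₁ = {a² ≡ 1 (mod p)}`
# (route `ManinLocalTwoThree`, cell bsd-f2-manin; cruxes C2 stmt-BirchSwinnertonDyer-22967 / C3 stmt-…-22968; LEAD seat p1 gen 12; the `p ∣ N`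
# steps of the LEAD's prime-generic shift-equaliser conjecture = typer's `ShiftEqualiser.PrimeShiftInvariantIsDiamond`)

`p`-GENERIC form of p3's `…ThreeShiftDescentEngine.lean`.  Level `pm`, `G = Γ₀(pm)`, `B = Γ₀(p·pm)` (`subB`), `A = {p ∣ b}`,
`φ : Γ₀(p·pm) → K` additive with `IsShiftEigenP p ε φ`.  For `p ≥ 5`, `A` is not normal in `G`, but p3's engine survives inside
**`G₁ = {a² ≡ 1 (mod p)}`** (`= G` for `p = 2, 3`): `A₁ = A ∩ G₁ ⊴ G`, `G₁ = A₁·⟨T⟩` with exponent map `n(γ) = a·b`, `Q₁ = (1−pm, pm; −pm, 1+pm)`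
generates `A₁` mod `A₁ ∩ B` (`p`-chotomy), and the `κ`-test is ONE equation `φ(P_{2/p}) = φ(P_{1/p})` (`P_{1/p} = (1−pm, m; −p²m, 1+pm)`,
`P_{2/p} = (1−2pm, 4m; −p²m, 1+2pm)`).  **`descentOn`**: under that equation (`coshift φ ε` on `A₁`, `restr φ` on `B`) glue to `W` additive ON
`G₁` (relativised `PShiftGlue.glueOn`); the extension to `G` is the sibling `…PShiftDescentExtend.lean`.  Nothing about BSD, Manin's
conjecture or C2/C3 is asserted here. [cite: DarmonDiamondTaylor1995, Lemma 4.28 (p. 135) (shape: degeneracy maps on `Γ₀`)]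
-/

set_option autoImplicit false
set_option linter.dupNamespace false

open scoped MatrixGroups

open CongruenceSubgroup Matrix.SpecialLinearGroup
  Summit.BirchSwinnertonDyer.Rank1Residual.ManinAdditive.NineShiftEqualiser

namespace Summit.BirchSwinnertonDyer.BirchSwinnertonDyer.Theorems.ManinLocalTwoThree

namespace PShiftEngine

open ThreeShiftDescent TwoShift PShiftTransfer PShiftGlue

variable {p : ℕ} [Fact p.Prime]

/-! ### §1. Entries mod `p` at a level divisible by `p` -/

section Entries

variable {L : ℕ}

/-- At a level `L` with `p ∣ L`, the lower-left entry vanishes mod `p`. [folklore] -/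
theorem ent10 (hpL : p ∣ L) (γ : Gamma0 L) : ent (p := p) (γ : SL(2, ℤ)) 1 0 = 0 :=
  (ent_eq_zero_iff _ 1 0).mpr ((Int.natCast_dvd_natCast.mpr hpL).trans
    ((ZMod.intCast_zmod_eq_zero_iff_dvd _ _).mp (Gamma0_mem.mp γ.2)))

/-- `a·d ≡ 1 (mod p)` at a level divisible by `p`. [folklore] -/
theorem ent_det (hpL : p ∣ L) (γ : Gamma0 L) : ent (p := p) (γ : SL(2, ℤ)) 0 0 * ent (γ : SL(2, ℤ)) 1 1 = 1 := by
  have h := det_ent (p := p) (γ : SL(2, ℤ))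
  rw [ent10 hpL γ, mul_zero, sub_zero] at h
  exact h

/-- Top-left entry of a product mod `p` (levels divisible by `p`: the Borel is a quotient). [folklore] -/
theorem ent00_mul (hpL : p ∣ L) (γ δ : Gamma0 L) :
    ent (p := p) ((γ * δ : Gamma0 L) : SL(2, ℤ)) 0 0 = ent (γ : SL(2, ℤ)) 0 0 * ent (δ : SL(2, ℤ)) 0 0 := by
  have e : (((γ * δ : Gamma0 L) : SL(2, ℤ)) 0 0 : ℤ) =
      (γ : SL(2, ℤ)) 0 0 * (δ : SL(2, ℤ)) 0 0 + (γ : SL(2, ℤ)) 0 1 * (δ : SL(2, ℤ)) 1 0 := by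
    simp [Matrix.mul_apply, Fin.sum_univ_two]
  have h10 : (((δ : SL(2, ℤ)) 1 0 : ℤ) : ZMod p) = 0 := ent10 hpL δ
  show ((((γ * δ : Gamma0 L) : SL(2, ℤ)) 0 0 : ℤ) : ZMod p) = _
  rw [e]; push_cast; rw [h10, mul_zero, add_zero]

/-- Top-right entry of a product mod `p`. [folklore] -/
theorem ent01_mul (γ δ : Gamma0 L) :
    ent (p := p) ((γ * δ : Gamma0 L) : SL(2, ℤ)) 0 1 =
      ent (γ : SL(2, ℤ)) 0 0 * ent (δ : SL(2, ℤ)) 0 1 + ent (γ : SL(2, ℤ)) 0 1 * ent (δ : SL(2, ℤ)) 1 1 := by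
  have e : (((γ * δ : Gamma0 L) : SL(2, ℤ)) 0 1 : ℤ) =
      (γ : SL(2, ℤ)) 0 0 * (δ : SL(2, ℤ)) 0 1 + (γ : SL(2, ℤ)) 0 1 * (δ : SL(2, ℤ)) 1 1 := by
    simp [Matrix.mul_apply, Fin.sum_univ_two]
  show ((((γ * δ : Gamma0 L) : SL(2, ℤ)) 0 1 : ℤ) : ZMod p) = _
  rw [e]; push_cast; rfl

/-- Entries of the inverse. [folklore] -/
theorem ent_inv (γ : Gamma0 L) :
    ent (p := p) ((γ⁻¹ : Gamma0 L) : SL(2, ℤ)) 0 0 = ent (γ : SL(2, ℤ)) 1 1 ∧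
    ent (p := p) ((γ⁻¹ : Gamma0 L) : SL(2, ℤ)) 0 1 = - ent (γ : SL(2, ℤ)) 0 1 ∧
    ent (p := p) ((γ⁻¹ : Gamma0 L) : SL(2, ℤ)) 1 1 = ent (γ : SL(2, ℤ)) 0 0 := by
  refine ⟨?_, ?_, ?_⟩ <;>
    simp [ent, Matrix.SpecialLinearGroup.coe_inv, Matrix.adjugate_fin_two]

/-- If `a² = 1` then `d = a` (mod `p`). [folklore] -/
theorem ent11_eq_ent00 (hpL : p ∣ L) (γ : Gamma0 L) (h : ent (p := p) (γ : SL(2, ℤ)) 0 0 ^ 2 = 1) :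
    ent (p := p) (γ : SL(2, ℤ)) 1 1 = ent (γ : SL(2, ℤ)) 0 0 := by
  have hd := ent_det hpL γ
  calc ent (p := p) (γ : SL(2, ℤ)) 1 1 = ent (γ : SL(2, ℤ)) 1 1 * ent (γ : SL(2, ℤ)) 0 0 ^ 2 := by rw [h, mul_one]
    _ = (ent (γ : SL(2, ℤ)) 0 0 * ent (γ : SL(2, ℤ)) 1 1) * ent (γ : SL(2, ℤ)) 0 0 := by ring
    _ = ent (γ : SL(2, ℤ)) 0 0 := by rw [hd, one_mul]

end Entries

/-! ### §2. The subgroups `G₁`, `A₁`, `B` of `Γ₀(pm)` -/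

section Subgroups

variable (p) (m : ℕ)

omit [Fact p.Prime] in
/-- `p ∣ pm`. [folklore] -/
theorem p_dvd_level : p ∣ p * m := dvd_mul_right p m

/-- **`G₁ = {γ ∈ Γ₀(pm) : a_γ² ≡ 1 (mod p)}`** — the preimage of `{±1}` under `γ ↦ a_γ mod p` (index `(p−1)/2`; all of `Γ₀(pm)` for
`p = 2, 3`). [folklore] -/
def subG1 : Subgroup (Gamma0 (p * m)) where
  carrier := {γ | ent (p := p) (γ : SL(2, ℤ)) 0 0 ^ 2 = 1}
  mul_mem' := by
    intro x y hx hy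
    simp only [Set.mem_setOf_eq] at hx hy ⊢
    rw [ent00_mul (p_dvd_level p m), mul_pow, hx, hy, one_mul]
  one_mem' := by simp [ent]
  inv_mem' := by
    intro x hx
    simp only [Set.mem_setOf_eq] at hx ⊢
    rw [(ent_inv x).1, ent11_eq_ent00 (p_dvd_level p m) x hx, hx]

/-- **`A₁ = {γ ∈ G₁ : p ∣ b_γ}`**. [folklore] -/
def subA1 : Subgroup (Gamma0 (p * m)) where
  carrier := {γ | ent (p := p) (γ : SL(2, ℤ)) 0 0 ^ 2 = 1 ∧ ent (p := p) (γ : SL(2, ℤ)) 0 1 = 0}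
  mul_mem' := by
    intro x y hx hy
    simp only [Set.mem_setOf_eq] at hx hy ⊢
    refine ⟨?_, ?_⟩
    · rw [ent00_mul (p_dvd_level p m), mul_pow, hx.1, hy.1, one_mul]
    · rw [ent01_mul, hx.2, hy.2, mul_zero, zero_mul, add_zero]
  one_mem' := by simp [ent]
  inv_mem' := by
    intro x hx
    simp only [Set.mem_setOf_eq] at hx ⊢
    refine ⟨?_, ?_⟩
    · rw [(ent_inv x).1, ent11_eq_ent00 (p_dvd_level p m) x hx.1, hx.1]
    · rw [(ent_inv x).2.1, hx.2, neg_zero]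

/-- **`B = Γ₀(p·pm)`** as a subgroup of `Γ₀(pm)`. [folklore] -/
def subB : Subgroup (Gamma0 (p * m)) where
  carrier := {γ | ((p * (p * m) : ℕ) : ℤ) ∣ ((γ : SL(2, ℤ)) 1 0 : ℤ)}
  mul_mem' := by
    intro x y hx hy
    simp only [Set.mem_setOf_eq] at hx hy ⊢
    have e : (((x * y : Gamma0 (p * m)) : SL(2, ℤ)) 1 0 : ℤ) =
        (x : SL(2, ℤ)) 1 0 * (y : SL(2, ℤ)) 0 0 + (x : SL(2, ℤ)) 1 1 * (y : SL(2, ℤ)) 1 0 := by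
      simp [Matrix.mul_apply, Fin.sum_univ_two]
    rw [e]
    exact dvd_add (Dvd.dvd.mul_right hx _) (Dvd.dvd.mul_left hy _)
  one_mem' := by simp
  inv_mem' := by
    intro x hx
    simp only [Set.mem_setOf_eq] at hx ⊢
    have e : (((x⁻¹ : Gamma0 (p * m)) : SL(2, ℤ)) 1 0 : ℤ) = -((x : SL(2, ℤ)) 1 0) := by
      simp [Matrix.SpecialLinearGroup.coe_inv, Matrix.adjugate_fin_two]
    rw [e]
    exact hx.neg_right

variable {p m}

/-- Membership in `G₁`. [folklore] -/
theorem mem_subG1 {γ : Gamma0 (p * m)} : γ ∈ subG1 p m ↔ ent (p := p) (γ : SL(2, ℤ)) 0 0 ^ 2 = 1 := Iff.rfl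
/-- Membership in `A₁`. [folklore] -/
theorem mem_subA1 {γ : Gamma0 (p * m)} :
    γ ∈ subA1 p m ↔ ent (p := p) (γ : SL(2, ℤ)) 0 0 ^ 2 = 1 ∧ ent (p := p) (γ : SL(2, ℤ)) 0 1 = 0 := Iff.rfl

omit [Fact p.Prime] in
/-- Membership in `B`. [folklore] -/
theorem mem_subB {γ : Gamma0 (p * m)} : γ ∈ subB p m ↔ ((p * (p * m) : ℕ) : ℤ) ∣ ((γ : SL(2, ℤ)) 1 0 : ℤ) := Iff.rfl

/-- `A₁ ≤ stabZero` (`p ∣ b`). [folklore] -/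
theorem stabZero_of_subA1 {γ : Gamma0 (p * m)} (h : γ ∈ subA1 p m) : γ ∈ stabZero p (p * m) :=
  mem_stabZero_iff.mpr ((ent_eq_zero_iff _ 0 1).mp h.2)

/-- **`A₁` is normal in `Γ₀(pm)`**: conjugation fixes `a mod p` and `b' ≡ a_g b_g (d − a) ≡ 0` since `d ≡ a` on `G₁`. [folklore] -/
theorem subA1_normal : (subA1 p m).Normal := by
  refine ⟨fun x hx g => ?_⟩
  have hpL := p_dvd_level p m
  rw [mem_subA1] at hx ⊢
  have hda : ent (p := p) (x : SL(2, ℤ)) 1 1 = ent (x : SL(2, ℤ)) 0 0 := ent11_eq_ent00 hpL x hx.1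
  have hg := ent_det hpL g
  obtain ⟨i00, i01, i11⟩ := ent_inv (p := p) g
  refine ⟨?_, ?_⟩
  · rw [ent00_mul hpL, ent00_mul hpL, i00, mul_right_comm, hg, one_mul, hx.1]
  · rw [ent01_mul, ent00_mul hpL, ent01_mul, i01, i11, hx.2, mul_zero, zero_add, hda]
    ring

omit [Fact p.Prime] in
/-- `T^k ∈ B`. [folklore] -/
theorem Tpow_mem_subB (k : ℤ) : Tpow (p * m) k ∈ subB p m := (mem_subB).mpr (dvd_zero _)

/-- `T^k ∈ G₁`. [folklore] -/
theorem Tpow_mem_subG1 (k : ℤ) : Tpow (p * m) k ∈ subG1 p m := by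
  rw [mem_subG1]; simp [Tpow, g0Of, ent]

omit [Fact p.Prime] in
/-- An element of `B` is `(a, b; c, d)` with `p·pm ∣ c`. [folklore] -/
theorem exists_eq_of_mem_subB {x : Gamma0 (p * m)} (hx : x ∈ subB p m) :
    ∃ (a b c d : ℤ) (h : a * d - b * c = 1) (hc : ((p * m : ℕ) : ℤ) ∣ c),
      ((p * (p * m) : ℕ) : ℤ) ∣ c ∧ x = g0Of a b c d h hc :=
  ⟨_, _, _, _, gamma0_det_entries x, ((ZMod.intCast_zmod_eq_zero_iff_dvd _ _).mp (Gamma0_mem.mp x.2)), mem_subB.mp hx,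
    (g0Of_entries x (gamma0_det_entries x) ((ZMod.intCast_zmod_eq_zero_iff_dvd _ _).mp (Gamma0_mem.mp x.2))).symm⟩

omit [Fact p.Prime] in
/-- `g0Of a b c d ∈ B` when `p·pm ∣ c`. [folklore] -/
theorem g0Of_mem_subB (a b c d : ℤ) (h : a * d - b * c = 1) (hc : ((p * m : ℕ) : ℤ) ∣ c)
    (hc' : ((p * (p * m) : ℕ) : ℤ) ∣ c) : (g0Of a b c d h hc : Gamma0 (p * m)) ∈ subB p m :=
  mem_subB.mpr hc'

end Subgroups

/-! ### §3. `restr φ` on `B`, agreement with the coshift, the exponent map -/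

section Pair

variable {K : Type*} [CommRing K] {m : ℕ} (φ : Gamma0 (p * (p * m)) → K) (ε : K)

omit [Fact p.Prime] in
/-- `restr φ` is additive on `B`. [folklore] -/
theorem restr_add_subB (hadd : IsAdd φ) :
    ∀ x ∈ subB p m, ∀ y ∈ subB p m, restr φ (x * y) = restr φ x + restr φ y := by
  intro x hx y hy
  obtain ⟨a, b, c, d, h, hc, hc9, rfl⟩ := exists_eq_of_mem_subB hx
  obtain ⟨a', b', c', d', h', hc', hc9', rfl⟩ := exists_eq_of_mem_subB hy
  have hc9'' : ((p * (p * m) : ℕ) : ℤ) ∣ c * a' + d * c' := dvd_add (Dvd.dvd.mul_right hc9 _) (Dvd.dvd.mul_left hc9' _)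
  rw [g0Of_mul a b c d a' b' c' d' h hc h' hc' (det_mul_entries h h')
      (dvd_add (Dvd.dvd.mul_right hc _) (Dvd.dvd.mul_left hc' _)),
    restr_g0Of φ _ _ _ _ _ _ hc9'', restr_g0Of φ a b c d h hc hc9, restr_g0Of φ a' b' c' d' h' hc' hc9', ← hadd,
    g0Of_mul]

/-- **Agreement on `stabZero ∩ B`**: `coshift φ ε = restr φ` there, from the eigen-property of `φ`. [folklore] -/
theorem coshift_eq_restr_subB (hinv : IsShiftEigenP p ε φ) :
    ∀ x ∈ stabZero p (p * m), x ∈ subB p m → coshift φ ε x = restr φ x := by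
  intro x hx hxB
  obtain ⟨a, b, c, d, h, hc, rfl⟩ := exists_eq_of_mem_stabZero hx
  have hc9 : ((p * (p * m) : ℕ) : ℤ) ∣ c := mem_subB.mp hxB
  rw [coshift_g0Of φ ε a b c d h hc (by linear_combination h) (dvd_p_mul' hc),
    restr_g0Of φ a (p * b) c d h hc hc9, hinv a b c d (by linear_combination h) hc9]

omit [Fact p.Prime] in
/-- `(T^1)^k = T^k` at level `pm`. [folklore] -/
theorem Tpow_one_zpow (k : ℤ) : (Tpow (p * m) 1) ^ k = Tpow (p * m) k := CubeStep.Tpow_one_zpow_any _ k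

/-- Entries mod `p` of `T^k`. [folklore] -/
theorem ent_Tpow (k : ℤ) :
    ent (p := p) ((Tpow (p * m) k : Gamma0 (p * m)) : SL(2, ℤ)) 0 0 = 1 ∧
    ent (p := p) ((Tpow (p * m) k : Gamma0 (p * m)) : SL(2, ℤ)) 0 1 = (k : ZMod p) ∧
    ent (p := p) ((Tpow (p * m) k : Gamma0 (p * m)) : SL(2, ℤ)) 1 1 = 1 := by
  refine ⟨?_, ?_, ?_⟩ <;> simp [Tpow, g0Of, ent]

/-- The exponent map `n(γ) := a·b`: for `γ ∈ G₁`, `γ · T^{−ab} ∈ A₁` (`b(1 − a²) ≡ 0`). [folklore] -/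
theorem mul_Tpow_neg_mem_subA1 (x : Gamma0 (p * m)) (hx : x ∈ subG1 p m) :
    x * (Tpow (p * m) 1) ^ (-(((x : SL(2, ℤ)) 0 0 : ℤ) * (x : SL(2, ℤ)) 0 1)) ∈ subA1 p m := by
  have hpL := p_dvd_level p m
  rw [mem_subG1] at hx
  set k : ℤ := -(((x : SL(2, ℤ)) 0 0 : ℤ) * (x : SL(2, ℤ)) 0 1) with hk
  obtain ⟨hT00, hT01, hT11⟩ := ent_Tpow (p := p) (m := m) k
  rw [Tpow_one_zpow, mem_subA1, ent00_mul hpL, ent01_mul, hT00, hT01, hT11, mul_one, hk]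
  refine ⟨hx, ?_⟩
  push_cast
  linear_combination (-(ent (p := p) (x : SL(2, ℤ)) 0 1)) * hx

/-- For `γ ∈ A₁`, `T^{n(γ)} ∈ A₁` (`p ∣ a b`). [folklore] -/
theorem Tpow_n_mem_subA1 (x : Gamma0 (p * m)) (hx : x ∈ subA1 p m) :
    (Tpow (p * m) 1) ^ (((x : SL(2, ℤ)) 0 0 : ℤ) * (x : SL(2, ℤ)) 0 1) ∈ subA1 p m := by
  rw [mem_subA1] at hx
  obtain ⟨hT00, hT01, -⟩ := ent_Tpow (p := p) (m := m) (((x : SL(2, ℤ)) 0 0 : ℤ) * (x : SL(2, ℤ)) 0 1)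
  rw [Tpow_one_zpow, mem_subA1, hT00, hT01]
  refine ⟨by rw [one_pow], ?_⟩
  push_cast
  rw [show (((x : SL(2, ℤ)) 0 1 : ℤ) : ZMod p) = ent (p := p) (x : SL(2, ℤ)) 0 1 from rfl, hx.2, mul_zero]

end Pair

/-! ### §4. `Q₁`, the `p`-chotomy, the parabolics `P_{1/p}`, `P_{2/p}`, and the descent inside `G₁` -/

section Engine

variable {K : Type*} [CommRing K] {m : ℕ} (φ : Gamma0 (p * (p * m)) → K) (ε : K)

/-- The element `Q₁ = (1 − pm, pm; −pm, 1 + pm) ∈ A₁` (a parabolic of `Γ₀(pm)` at the cusp `1`). [folklore] -/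
def Q1 (p m : ℕ) : Gamma0 (p * m) :=
  g0Of (1 - p * m) (p * m) (-(p * m)) (1 + p * m) (by ring) ⟨-1, by push_cast; ring⟩

omit [Fact p.Prime] in
/-- Powers of `Q₁`: `Q₁^j = (1 − j pm, j pm; −j pm, 1 + j pm)`. [folklore] -/
theorem Q1_zpow (j : ℤ) : (Q1 p m) ^ j =
    g0Of (1 - j * (p * m)) (j * (p * m)) (-(j * (p * m))) (1 + j * (p * m)) (by ring) ⟨-j, by push_cast; ring⟩ := by
  induction j using Int.induction_on with
  | zero =>
    rw [zpow_zero]; apply Subtype.ext; ext i j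
    fin_cases i <;> fin_cases j <;> simp [g0Of, slOf]
  | succ n ih =>
    rw [zpow_add_one, ih, Q1, g0Of_mul _ _ _ _ _ _ _ _ _ _ _ _ (det_mul_entries (by ring) (by ring))
      ⟨-((n : ℤ) + 1), by push_cast; ring⟩]
    exact g0Of_congr (by ring) (by ring) (by ring) (by ring) _ _ _ _
  | pred n ih =>
    have hinv : (Q1 p m)⁻¹ = g0Of (1 + p * m) (-(p * m)) (p * m) (1 - p * m) (by ring) ⟨1, by push_cast; ring⟩ := by
      rw [inv_eq_iff_mul_eq_one, Q1, g0Of_mul _ _ _ _ _ _ _ _ _ _ _ _ (by ring) ⟨0, by push_cast; ring⟩]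
      apply Subtype.ext; ext i j
      fin_cases i <;> fin_cases j <;> simp [g0Of, slOf] <;> ring
    rw [zpow_sub_one, ih, hinv, g0Of_mul _ _ _ _ _ _ _ _ _ _ _ _ (det_mul_entries (by ring) (by ring))
      ⟨-(-(n : ℤ) - 1), by push_cast; ring⟩]
    exact g0Of_congr (by ring) (by ring) (by ring) (by ring) _ _ _ _

/-- `Q₁ ∈ A₁`. [folklore] -/
theorem Q1_mem_subA1 : Q1 p m ∈ subA1 p m := by
  rw [mem_subA1, Q1]
  constructor <;> simp [g0Of, ent]

/-- **`Q₁` generates `A₁` modulo `A₁ ∩ B`** (the `p`-chotomy): for `x ∈ A₁` some `x Q₁^{−e}` lies in `B`. [folklore] -/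
theorem exists_mul_Q1_zpow_mem_subB (x : Gamma0 (p * m)) (hx : x ∈ subA1 p m) :
    ∃ e : ℤ, x * (Q1 p m) ^ (-e) ∈ subB p m := by
  have hp : p.Prime := Fact.out
  obtain ⟨a, b, c, d, h, hc, rfl⟩ := exists_eq_of_mem_stabZero (stabZero_of_subA1 hx)
  obtain ⟨c₀, hc₀⟩ := hc
  -- `d` is a unit mod `p`; choose `e ≡ −c₀ d⁻¹ (mod p)`, so that `p ∣ c₀ + e d`
  have hd : ((d : ℤ) : ZMod p) ≠ 0 := by
    have h1 := congrArg (Int.cast : ℤ → ZMod p) h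
    push_cast at h1
    rw [ZMod.natCast_self, zero_mul, zero_mul, sub_zero] at h1
    intro h0
    rw [h0, mul_zero] at h1
    exact zero_ne_one h1
  set e : ℤ := ((((-((c₀ : ℤ) : ZMod p)) * (((d : ℤ) : ZMod p))⁻¹).val : ℕ) : ℤ) with he
  have hed : (p : ℤ) ∣ c₀ + e * d := by
    refine (ZMod.intCast_zmod_eq_zero_iff_dvd _ p).mp ?_
    push_cast
    rw [he, Int.cast_natCast, ZMod.natCast_zmod_val, mul_assoc, inv_mul_cancel₀ hd, mul_one, add_neg_cancel]
  refine ⟨e, ?_⟩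
  rw [Q1_zpow, g0Of_mul _ _ _ _ _ _ _ _ _ _ _ _ (det_mul_entries h (by ring))
    (dvd_add (Dvd.dvd.mul_right ⟨c₀, hc₀⟩ _) (Dvd.dvd.mul_left ⟨-(-e), by push_cast; ring⟩ _)), mem_subB]
  show ((p * (p * m) : ℕ) : ℤ) ∣ c * (1 - -e * (p * m)) + d * -(-e * (p * m))
  obtain ⟨k, hk⟩ := hed
  refine ⟨k + m * e * c₀, ?_⟩
  rw [hc₀]
  push_cast
  linear_combination ((p : ℤ) * m) * hk

/-- The parabolic `P_{1/p} = (1 − pm, m; −p²m, 1 + pm) ∈ Γ₀(p²m)` at the cusp `1/p` (the `p`-shift partner of `Q₁`). [folklore] -/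
def P1p (p m : ℕ) : Gamma0 (p * (p * m)) :=
  g0Of (1 - p * m) m (-(p * (p * m))) (1 + p * m) (by ring) ⟨-1, by push_cast; ring⟩

/-- The parabolic `P_{2/p} = (1 − 2pm, 4m; −p²m, 1 + 2pm) ∈ Γ₀(p²m)` at the cusp `2/p` (the partner of `T Q₁ T⁻¹`). [folklore] -/
def P2p (p m : ℕ) : Gamma0 (p * (p * m)) :=
  g0Of (1 - 2 * (p * m)) (4 * m) (-(p * (p * m))) (1 + 2 * (p * m)) (by ring) ⟨-1, by push_cast; ring⟩

/-- `coshift φ ε Q₁ = ε φ(P_{1/p})`. [folklore] -/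
theorem coshift_Q1 : coshift φ ε (Q1 p m) = ε * φ (P1p p m) := by
  rw [Q1, coshift_g0Of φ ε (1 - p * m) m (-(p * m)) (1 + p * m) (by ring) _ (by ring) ⟨-1, by push_cast; ring⟩, P1p]
  congr 2
  exact g0Of_congr rfl rfl (by ring) rfl _ _ _ _

/-- `coshift φ ε (T Q₁ T⁻¹) = ε φ(P_{2/p})`. [folklore] -/
theorem coshift_conj_Q1 : coshift φ ε (Tpow (p * m) 1 * Q1 p m * (Tpow (p * m) 1)⁻¹) = ε * φ (P2p p m) := by
  rw [Tpow_inv, Q1, Tpow_one_mul_mul_Tpow_neg_one _ _ _ _ _ _ (by ring)]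
  have e : g0Of (M := p * m) (1 - (p : ℤ) * m + -(p * m)) (p * m + (1 + p * m) - (1 - p * m) - -(p * m)) (-(p * m))
        (1 + p * m - -(p * m)) (by ring) ⟨-1, by push_cast; ring⟩ =
      g0Of (1 - 2 * (p * m)) (p * (4 * m)) (-(p * m)) (1 + 2 * (p * m)) (by ring) ⟨-1, by push_cast; ring⟩ :=
    g0Of_congr (by ring) (by ring) rfl (by ring) _ _ _ _
  rw [e, coshift_g0Of φ ε (1 - 2 * (p * m)) (4 * m) (-(p * m)) (1 + 2 * (p * m)) (by ring) _ (by ring)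
    ⟨-1, by push_cast; ring⟩, P2p]
  congr 2
  exact g0Of_congr rfl rfl (by ring) rfl _ _ _ _

/-- **THE DESCENT INSIDE `G₁`.**  For `φ : Γ₀(p²m) → K` additive with `IsShiftEigenP p ε φ` and `φ(P_{2/p}) = φ(P_{1/p})`, the glued
function `W(g) := coshift φ ε (g T^{−a_g b_g}) + (a_g b_g)·restr φ (T)` is additive on `G₁`, equals `coshift φ ε` on `A₁` and `restr φ` on
`B ∩ G₁`. [folklore] -/
theorem descentOn (hadd : IsAdd φ) (hinv : IsShiftEigenP p ε φ) (hP : φ (P2p p m) = φ (P1p p m)) :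
    (∀ g ∈ subG1 p m, ∀ h ∈ subG1 p m,
        (coshift φ ε (g * h * Tpow (p * m) 1 ^ (-((((g * h : Gamma0 (p * m)) : SL(2, ℤ)) 0 0 : ℤ) * ((g * h : Gamma0 (p * m)) : SL(2, ℤ)) 0 1)))
          + ((((g * h : Gamma0 (p * m)) : SL(2, ℤ)) 0 0 : ℤ) * ((g * h : Gamma0 (p * m)) : SL(2, ℤ)) 0 1) • restr φ (Tpow (p * m) 1)) =
        (coshift φ ε (g * Tpow (p * m) 1 ^ (-(((g : SL(2, ℤ)) 0 0 : ℤ) * (g : SL(2, ℤ)) 0 1)))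
          + (((g : SL(2, ℤ)) 0 0 : ℤ) * (g : SL(2, ℤ)) 0 1) • restr φ (Tpow (p * m) 1)) +
        (coshift φ ε (h * Tpow (p * m) 1 ^ (-(((h : SL(2, ℤ)) 0 0 : ℤ) * (h : SL(2, ℤ)) 0 1)))
          + (((h : SL(2, ℤ)) 0 0 : ℤ) * (h : SL(2, ℤ)) 0 1) • restr φ (Tpow (p * m) 1))) ∧
    (∀ a ∈ subA1 p m,
        coshift φ ε (a * Tpow (p * m) 1 ^ (-(((a : SL(2, ℤ)) 0 0 : ℤ) * (a : SL(2, ℤ)) 0 1)))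
          + (((a : SL(2, ℤ)) 0 0 : ℤ) * (a : SL(2, ℤ)) 0 1) • restr φ (Tpow (p * m) 1) = coshift φ ε a) ∧
    (∀ b ∈ subB p m, b ∈ subG1 p m →
        coshift φ ε (b * Tpow (p * m) 1 ^ (-(((b : SL(2, ℤ)) 0 0 : ℤ) * (b : SL(2, ℤ)) 0 1)))
          + (((b : SL(2, ℤ)) 0 0 : ℤ) * (b : SL(2, ℤ)) 0 1) • restr φ (Tpow (p * m) 1) = restr φ b) := by
  have hAn := subA1_normal (p := p) (m := m)
  have hα : ∀ x ∈ subA1 p m, ∀ y ∈ subA1 p m, coshift φ ε (x * y) = coshift φ ε x + coshift φ ε y :=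
    fun x hx y hy => coshift_add φ ε hadd x (stabZero_of_subA1 hx) y (stabZero_of_subA1 hy)
  have hφ' := restr_add_subB (p := p) (m := m) φ hadd
  have hC : ∀ x ∈ subA1 p m, x ∈ subB p m → coshift φ ε x = restr φ x :=
    fun x hx hxB => coshift_eq_restr_subB φ ε hinv x (stabZero_of_subA1 hx) hxB
  have ht : Tpow (p * m) 1 ∈ subB p m := Tpow_mem_subB 1
  have hκ : coshift φ ε (Tpow (p * m) 1 * Q1 p m * (Tpow (p * m) 1)⁻¹) = coshift φ ε (Q1 p m) := by
    rw [coshift_conj_Q1, coshift_Q1, hP]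
  have hinvT := conj_invariant_of_generator hAn hα hφ' hC ht Q1_mem_subA1 (exists_mul_Q1_zpow_mem_subB) hκ
  exact glueOn (fun g _ a ha => hAn.conj_mem a ha g) hα hφ' hC ht (Tpow_mem_subG1 1) hinvT
    (fun g => ((g : SL(2, ℤ)) 0 0 : ℤ) * (g : SL(2, ℤ)) 0 1) mul_Tpow_neg_mem_subA1 Tpow_n_mem_subA1

end Engine

end PShiftEngine

end Summit.BirchSwinnertonDyer.BirchSwinnertonDyer.Theorems.ManinLocalTwoThree
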